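import Summits.AtomisticToContinuum.Crystallization.Theorems.FrustratedLawDichotomyCellGridFree
import Summits.AtomisticToContinuum.Crystallization.Theorems.FrustratedLawDichotomyCellData

/-!
# FrustratedLawDichotomy · crux `AperiodicFrustratedLawGap` (stmt-AtomisticToContinuum-27623) — CELL-SOUND XII: CLASS-H WINDOWS IN THE
LABEL FRAME (cell decomp-a2c, lens-5 g113; crit r1773 (C) «clearance_of_intNormal», made orientation-free)

A class-H cell (half-ball window `haloWindow n s Rc = closedBall 0 Rc ∩ {⟪x,n⟫ ≤ s}`, (253) `rowFloorHalo_of_cells`) must CO-ROTATE its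
window with the cell matrix `F` (the box `nearIdBox ε` is `O(3)`-saturated).  Window of record: an INTEGER label normal `n₁` and a RATIONAL
level `S`, placed by `F`:
`nL F n₁ := ‖F n₁‖⁻¹ • F n₁` (unit), `sL F n₁ S := S·‖F n₁‖⁻¹`, so that `⟪x, nL⟫ ≤ sL ⟺ ⟪x, F n₁⟫ ≤ S` (`inner_nL_le_sL_iff`) and for a
template site `⟪F a, F n₁⟫ = gram(FᵀF) a n₁` is Gram data.  Then every window hypothesis of (253) is discharged from RATIONAL facts:
* `norm_nL` (`‖n‖ = 1`), `one_le_sL` (`1 ≤ s` from `N_hi ≤ S`), `inner_add_le_sL` (sites inside: `g_hi + τ·N_hi ≤ S`),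
  `clearance_le` (interior clearances: `d + τ ≤ (S − g_hi)/N_hi`), with the bracket `‖F n₁‖ ≤ N_hi` from (260) `norm_le_of_nearId` and
  `g_hi` from ★ `gram_le_dot_add` (`|gram G a n − a·n| ≤ ε·Σ|aᵢ|·Σ|nⱼ|` on the strain box);
* the COVER for co-rotating windows: `haloWindow_nL_subset` (`{⟪x, F′n₁⟫ ≤ S} ∩ ball ⊆ {⟪x, F n₁⟫ ≤ S + Rc·ρ} ∩ ball` when
  `‖F n₁ − F′ n₁‖ ≤ ρ`) and ★★ `rowHalo_cover_dial` — real `F ∈ nearIdBox ε_cov` at `(τ_cov, S⁺)` land in the rational rows at `(τ_row, S)`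
  whenever `τ_cov + 3ηA ≤ τ_row`, `ε_cov + 3η(2+2ε_cov+η) ≤ ε`, `S + Rc·ρ ≤ S⁺`, `3η‖n₁‖₂ ≤ ρ` ((264) supplies the rounding).

House conventions: SI units · italic scalars, bold vectors, sans-serif tensors · numbered formulae only when referenced · en-dash for
ranges · References = cited works, numbered, alphabetical · no footnotes; Remarks at section ends · British spelling, -ise · Lennard-Jones
hyphenated; NASH capitalised as the Statement's notion · "folklore" tags standard bookkeeping; no new references are cited in this file.
-/

noncomputable section

namespace Summit.AtomisticToContinuum.Crystallization.Theorems.FrustratedLawDichotomyCellHaloNormal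

open MeasureTheory Metric Set
open scoped BigOperators RealInnerProductSpace
open Summit.AtomisticToContinuum.Crystallization.Theorems.ChargedEnergyGapNegative (E3)
open Summit.AtomisticToContinuum.Crystallization.Theorems.FrustratedLawDichotomyCoherentOn (coherentOn coherentOn_anti)
open Summit.AtomisticToContinuum.Crystallization.Theorems.FrustratedLawDichotomyCoherentFloorHalo (haloWindow)
open Summit.AtomisticToContinuum.Crystallization.Theorems.FrustratedLawDichotomyCellRows (ratBox mem_ratBox)
open Summit.AtomisticToContinuum.Crystallization.Theorems.FrustratedLawDichotomyCellMetric (posL gram inner_posL norm_sq_posL)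
open Summit.AtomisticToContinuum.Crystallization.Theorems.FrustratedLawDichotomyCellData (gram_ge_nearId norm_le_of_nearId)
open Summit.AtomisticToContinuum.Crystallization.Theorems.FrustratedLawDichotomyCellGrid (coherentOn_mono_of_moved norm_posL_sub_posL_le)
open Summit.AtomisticToContinuum.Crystallization.Theorems.FrustratedLawDichotomyCellGridFree
  (nearIdBox exists_rat_near_free mem_nearIdBox_of_moved)

variable {ι : Type*}

/-! ## §1. The placed normal and level -/

/-- the placed UNIT NORMAL of the label normal `n₁`: `‖F n₁‖⁻¹ • F n₁`. -/
def nL (F : Matrix (Fin 3) (Fin 3) ℝ) (n₁ : Fin 3 → ℝ) : E3 := ‖posL F n₁‖⁻¹ • posL F n₁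

/-- the placed LEVEL of the rational level `S`: `S·‖F n₁‖⁻¹` (so that `⟪x, nL⟫ ≤ sL ⟺ ⟪x, F n₁⟫ ≤ S`). -/
def sL (F : Matrix (Fin 3) (Fin 3) ℝ) (n₁ : Fin 3 → ℝ) (S : ℝ) : ℝ := S * ‖posL F n₁‖⁻¹

section Window

variable (F : Matrix (Fin 3) (Fin 3) ℝ) (n₁ : Fin 3 → ℝ)

/-- ★ the `hn` clause: the placed normal is a unit vector. [folklore] -/
theorem norm_nL (h : 0 < ‖posL F n₁‖) : ‖nL F n₁‖ = 1 := by
  unfold nL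
  rw [norm_smul, Real.norm_eq_abs, abs_of_pos (inv_pos.mpr h), inv_mul_cancel₀ h.ne']

/-- ★ the half-space of the placed window is `{⟪x, F n₁⟫ ≤ S}`. [folklore] -/
theorem inner_nL_le_sL_iff (h : 0 < ‖posL F n₁‖) (S : ℝ) (x : E3) : ⟪x, nL F n₁⟫ ≤ sL F n₁ S ↔ ⟪x, posL F n₁⟫ ≤ S := by
  unfold nL sL
  rw [real_inner_smul_right, mul_comm]
  exact mul_le_mul_iff_of_pos_right (inv_pos.mpr h)

/-- the pairing of the placed normal with any vector. [folklore] -/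
theorem inner_nL (x : E3) : ⟪x, nL F n₁⟫ = ⟪x, posL F n₁⟫ * ‖posL F n₁‖⁻¹ := by
  unfold nL
  rw [real_inner_smul_right, mul_comm]

/-- the pairing of a placed site with the placed normal is Gram data over the norm. [folklore] -/
theorem inner_posL_nL (a : Fin 3 → ℝ) : ⟪posL F a, nL F n₁⟫ = gram (F.transpose * F) a n₁ * ‖posL F n₁‖⁻¹ := by
  rw [inner_nL, inner_posL]

/-- a positive lower bracket of `‖F n₁‖` on the strain box: `0 < (1 − 3ε)·|n₁|²` ⇒ `0 < ‖F n₁‖`. [folklore] -/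
theorem norm_posL_pos_of_nearId {ε : ℝ} (hG : ∀ i j, |(F.transpose * F) i j - (if i = j then 1 else 0)| ≤ ε)
    (hpos : 0 < (1 - 3 * ε) * ∑ i, n₁ i ^ 2) : 0 < ‖posL F n₁‖ := by
  have h := (gram_ge_nearId hG n₁).trans_eq (norm_sq_posL F n₁).symm
  have h2 : 0 < ‖posL F n₁‖ ^ 2 := hpos.trans_le h
  exact lt_of_le_of_ne (norm_nonneg _) (fun h0 => by rw [← h0] at h2; simp at h2)

/-! ## §2. Mixed Gram pairings on the strain box -/

omit F n₁ in
/-- ★ `|gram G a n − a·n| ≤ ε·Σᵢ|aᵢ|·Σⱼ|nⱼ|` when `|G − 1|ᵢⱼ ≤ ε`. [folklore] -/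
theorem abs_gram_sub_dot_le {G : Matrix (Fin 3) (Fin 3) ℝ} {ε : ℝ} (hG : ∀ i j, |G i j - (if i = j then 1 else 0)| ≤ ε)
    (a n : Fin 3 → ℝ) : |gram G a n - ∑ i, a i * n i| ≤ ε * ((∑ i, |a i|) * ∑ j, |n j|) := by
  have hid : gram G a n - ∑ i, a i * n i = ∑ i, ∑ j, (G i j - (if i = j then 1 else 0)) * (a i * n j) := by
    have hdot : ∑ i, a i * n i = ∑ i, ∑ j, (if i = j then (1 : ℝ) else 0) * (a i * n j) := by
      refine Finset.sum_congr rfl fun i _ => ?_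
      rw [Finset.sum_eq_single i (fun j _ hj => by rw [if_neg (Ne.symm hj), zero_mul]) (fun h => (h (Finset.mem_univ i)).elim)]
      simp
    unfold gram
    rw [hdot, ← Finset.sum_sub_distrib]
    refine Finset.sum_congr rfl fun i _ => ?_
    rw [← Finset.sum_sub_distrib]
    refine Finset.sum_congr rfl fun j _ => by ring
  rw [hid, Finset.sum_mul_sum]
  calc |∑ i, ∑ j, (G i j - (if i = j then 1 else 0)) * (a i * n j)|
      ≤ ∑ i, |∑ j, (G i j - (if i = j then 1 else 0)) * (a i * n j)| := Finset.abs_sum_le_sum_abs _ _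
    _ ≤ ∑ i, ∑ j, |(G i j - (if i = j then 1 else 0)) * (a i * n j)| := Finset.sum_le_sum fun i _ => Finset.abs_sum_le_sum_abs _ _
    _ ≤ ∑ i, ∑ j, ε * (|a i| * |n j|) := Finset.sum_le_sum fun i _ => Finset.sum_le_sum fun j _ => by
        rw [abs_mul, abs_mul]
        exact mul_le_mul_of_nonneg_right (hG i j) (by positivity)
    _ = ε * ∑ i, ∑ j, |a i| * |n j| := by rw [Finset.mul_sum]; exact Finset.sum_congr rfl fun i _ => by rw [Finset.mul_sum]

omit F n₁ in
/-- ★ the upper corner of a mixed pairing: `gram G a n ≤ a·n + ε·Σ|aᵢ|·Σ|nⱼ|` (the `g_hi` of the clause dischargers below; for integer data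
at scale `h` both sums are exact rationals). [folklore] -/
theorem gram_le_dot_add {G : Matrix (Fin 3) (Fin 3) ℝ} {ε : ℝ} (hG : ∀ i j, |G i j - (if i = j then 1 else 0)| ≤ ε) (a n : Fin 3 → ℝ) :
    gram G a n ≤ ∑ i, a i * n i + ε * ((∑ i, |a i|) * ∑ j, |n j|) := by
  have := (abs_le.mp (abs_gram_sub_dot_le hG a n)).2; linarith

omit F n₁ in
/-- the lower corner. [folklore] -/
theorem dot_sub_le_gram {G : Matrix (Fin 3) (Fin 3) ℝ} {ε : ℝ} (hG : ∀ i j, |G i j - (if i = j then 1 else 0)| ≤ ε) (a n : Fin 3 → ℝ) :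
    ∑ i, a i * n i - ε * ((∑ i, |a i|) * ∑ j, |n j|) ≤ gram G a n := by
  have := (abs_le.mp (abs_gram_sub_dot_le hG a n)).1; linarith

/-! ## §3. The window clauses of (253) from rational facts -/

/-- ★ the `hs` clause `1 ≤ s`: from `‖F n₁‖ ≤ N_hi ≤ S`. [folklore] -/
theorem one_le_sL {Nhi S : ℝ} (h0 : 0 < ‖posL F n₁‖) (hN : ‖posL F n₁‖ ≤ Nhi) (hS : Nhi ≤ S) : 1 ≤ sL F n₁ S := by
  unfold sL
  rw [← div_eq_mul_inv, one_le_div h0]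
  linarith

/-- ★ the `hin` half-space clause for a placed site: `⟪F a, n⟫ + τ ≤ s` from `g_hi + τ·N_hi ≤ S`. [folklore] -/
theorem inner_add_le_sL {ghi Nhi S τ : ℝ} (h0 : 0 < ‖posL F n₁‖) (hN : ‖posL F n₁‖ ≤ Nhi) (a : Fin 3 → ℝ)
    (hg : gram (F.transpose * F) a n₁ ≤ ghi) (hτ : 0 ≤ τ) (h : ghi + τ * Nhi ≤ S) : ⟪posL F a, nL F n₁⟫ + τ ≤ sL F n₁ S := by
  rw [inner_posL_nL]
  unfold sL
  have hN0 := h0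
  have key : gram (F.transpose * F) a n₁ + τ * ‖posL F n₁‖ ≤ S := by nlinarith
  have : (gram (F.transpose * F) a n₁ + τ * ‖posL F n₁‖) * ‖posL F n₁‖⁻¹ ≤ S * ‖posL F n₁‖⁻¹ :=
    mul_le_mul_of_nonneg_right key (inv_nonneg.mpr (norm_nonneg _))
  calc gram (F.transpose * F) a n₁ * ‖posL F n₁‖⁻¹ + τ
      = (gram (F.transpose * F) a n₁ + τ * ‖posL F n₁‖) * ‖posL F n₁‖⁻¹ := by field_simp
    _ ≤ S * ‖posL F n₁‖⁻¹ := this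

/-- ★ the `hI` clearance clause for an interior site: `d ≤ s − (⟪F a, n⟫ + τ)` from `d + τ ≤ (S − g_hi)/N_hi`, `0 ≤ S − g_hi`. [folklore] -/
theorem clearance_le {ghi Nhi S τ d : ℝ} (h0 : 0 < ‖posL F n₁‖) (hN : ‖posL F n₁‖ ≤ Nhi) (a : Fin 3 → ℝ)
    (hg : gram (F.transpose * F) a n₁ ≤ ghi) (hS : 0 ≤ S - ghi) (hd : d + τ ≤ (S - ghi) / Nhi) :
    d ≤ sL F n₁ S - (⟪posL F a, nL F n₁⟫ + τ) := by
  rw [inner_posL_nL]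
  unfold sL
  have hNhi : 0 < Nhi := h0.trans_le hN
  have h1 : (S - ghi) / Nhi ≤ (S - ghi) / ‖posL F n₁‖ := div_le_div_of_nonneg_left hS h0 hN
  have h2 : (S - ghi) / ‖posL F n₁‖ ≤ (S - gram (F.transpose * F) a n₁) / ‖posL F n₁‖ :=
    div_le_div_of_nonneg_right (by linarith) h0.le
  have h3 : (S - gram (F.transpose * F) a n₁) / ‖posL F n₁‖
      = S * ‖posL F n₁‖⁻¹ - gram (F.transpose * F) a n₁ * ‖posL F n₁‖⁻¹ := by rw [div_eq_mul_inv]; ring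
  linarith

/-- the ball clause is unchanged from class A ((260) `norm_add_le_of_nearId`); for the record, the bracket `‖F n₁‖ ≤ N_hi` itself:
`(1 + 3ε)·|n₁|² ≤ N_hi²` ⇒ `‖F n₁‖ ≤ N_hi`. [folklore] -/
theorem norm_posL_le_bracket {ε Nhi : ℝ} (hG : ∀ i j, |(F.transpose * F) i j - (if i = j then 1 else 0)| ≤ ε) (hNhi : 0 ≤ Nhi)
    (h : (1 + 3 * ε) * ∑ i, n₁ i ^ 2 ≤ Nhi ^ 2) : ‖posL F n₁‖ ≤ Nhi :=
  norm_le_of_nearId hG hNhi h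

end Window

/-! ## §4. Co-rotating windows move little: the class-H cover -/

/-- ★ WINDOW COMPARISON: if `‖F n₁ − F′ n₁‖ ≤ ρ` then the `F′`-window at level `S` sits inside the `F`-window at level `S + Rc·ρ`.
[folklore] -/
theorem haloWindow_nL_subset {F F' : Matrix (Fin 3) (Fin 3) ℝ} {n₁ : Fin 3 → ℝ} {ρ S Splus Rc : ℝ} (hF : 0 < ‖posL F n₁‖)
    (hF' : 0 < ‖posL F' n₁‖) (hρ : ‖posL F n₁ - posL F' n₁‖ ≤ ρ) (hS : S + Rc * ρ ≤ Splus) :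
    haloWindow (nL F' n₁) (sL F' n₁ S) Rc ⊆ haloWindow (nL F n₁) (sL F n₁ Splus) Rc := by
  intro x hx
  unfold haloWindow at hx ⊢
  obtain ⟨hball, hhalf⟩ := hx
  refine ⟨hball, ?_⟩
  rw [Set.mem_setOf_eq] at hhalf ⊢
  rw [inner_nL_le_sL_iff F' n₁ hF'] at hhalf
  rw [inner_nL_le_sL_iff F n₁ hF]
  have hxR : ‖x‖ ≤ Rc := by rw [mem_closedBall, dist_zero_right] at hball; exact hball
  have hsplit : ⟪x, posL F n₁⟫ = ⟪x, posL F' n₁⟫ + ⟪x, posL F n₁ - posL F' n₁⟫ := by rw [← inner_add_right]; congr 1; abel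
  have hcs : ⟪x, posL F n₁ - posL F' n₁⟫ ≤ ‖x‖ * ‖posL F n₁ - posL F' n₁‖ := real_inner_le_norm _ _
  have hρ0 : 0 ≤ ρ := (norm_nonneg _).trans hρ
  have : ‖x‖ * ‖posL F n₁ - posL F' n₁‖ ≤ Rc * ρ := mul_le_mul hxR hρ (norm_nonneg _) ((norm_nonneg _).trans hxR)
  linarith

/-- ★★ **CLASS-H GRID TOLERANCE WITH CO-ROTATING WINDOWS.**  Template `a` (`‖a m‖₂ ≤ A` on `M`), integer normal `n₁` (`3η‖n₁‖₂ ≤ ρ`,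
`0 < (1 − 3ε)·|n₁|²`), levels `S ≤ S⁺ − Rc·ρ`, radii `τ_cov + 3ηA ≤ τ_row`, boxes `ε_cov + 3η(2 + 2ε_cov + η) ≤ ε`, `ε_cov ≤ ε`: every
configuration coherent for SOME real `F ∈ nearIdBox ε_cov` on the `F`-window at `(τ_cov, S⁺)` is coherent for a RATIONAL `F′ ∈ nearIdBox ε`
on the `F′`-window at `(τ_row, S)`. [folklore] -/
theorem rowHalo_cover_dial (M : Finset ι) (a : ι → Fin 3 → ℝ) (n₁ : Fin 3 → ℝ) {εc ε τc τr η A ρ S Splus : ℝ} (Rc : ℝ)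
    (hη : 0 < η) (hεc : 0 ≤ εc) (hεcε : εc ≤ ε) (hpos : 0 < (1 - 3 * ε) * ∑ i, n₁ i ^ 2)
    (hA : ∀ m ∈ M, ‖posL 1 (a m)‖ ≤ A) (hτ : τc + 3 * η * A ≤ τr) (hεε : εc + 3 * η * (2 + 2 * εc + η) ≤ ε)
    (hρ : 3 * η * ‖posL 1 n₁‖ ≤ ρ) (hS : S + Rc * ρ ≤ Splus) :
    (⋃ F ∈ nearIdBox εc, coherentOn (M.image fun m => posL F (a m)) τc (haloWindow (nL F n₁) (sL F n₁ Splus) Rc))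
      ⊆ ⋃ F ∈ ratBox (nearIdBox ε), coherentOn (M.image fun m => posL F (a m)) τr (haloWindow (nL F n₁) (sL F n₁ S) Rc) := by
  intro μ hμ
  obtain ⟨F, hF, hcoh⟩ := Set.mem_iUnion₂.mp hμ
  obtain ⟨f, hFf⟩ := exists_rat_near_free F hη
  set F' : Matrix (Fin 3) (Fin 3) ℝ := Matrix.of fun i j => ((f i j : ℚ) : ℝ) with hF'def
  have hF'box : F' ∈ nearIdBox ε := mem_nearIdBox_of_moved (F' := F') hF hεc (fun i j => hFf i j) hεε
  have hF'rat : F' ∈ ratBox (nearIdBox ε) := mem_ratBox f hF'box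
  refine Set.mem_iUnion₂.mpr ⟨F', hF'rat, ?_⟩
  -- positivity of both placed normals
  have hposc : 0 < (1 - 3 * εc) * ∑ i, n₁ i ^ 2 := by
    have hs : 0 ≤ ∑ i, n₁ i ^ 2 := Finset.sum_nonneg fun i _ => sq_nonneg _
    nlinarith
  have h0 : 0 < ‖posL F n₁‖ := norm_posL_pos_of_nearId F n₁ hF hposc
  have h0' : 0 < ‖posL F' n₁‖ := norm_posL_pos_of_nearId F' n₁ hF'box hpos
  -- move the template inside the big window, then shrink the window
  have hmove : ∀ m ∈ M, dist (posL F (a m)) (posL F' (a m)) ≤ τr - τc := by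
    intro m hm
    rw [dist_eq_norm]
    refine (norm_posL_sub_posL_le (F' := F') (fun i j => hFf i j) (a m)).trans ?_
    have := mul_le_mul_of_nonneg_left (hA m hm) (by positivity : (0 : ℝ) ≤ 3 * η)
    linarith
  have h1 := coherentOn_mono_of_moved M (fun m => posL F (a m)) (fun m => posL F' (a m))
    (haloWindow (nL F n₁) (sL F n₁ Splus) Rc) hmove hcoh
  have hρ' : ‖posL F n₁ - posL F' n₁‖ ≤ ρ := (norm_posL_sub_posL_le (F' := F') (fun i j => hFf i j) n₁).trans hρ
  have hW := haloWindow_nL_subset (Rc := Rc) h0 h0' hρ' hS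
  have h2 := coherentOn_anti (M.image fun m => posL F' (a m)) (τc + (τr - τc)) hW h1
  simpa using h2

end Summit.AtomisticToContinuum.Crystallization.Theorems.FrustratedLawDichotomyCellHaloNormal

end
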